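import Literature.AlgebraicGeometry.Modules.BoxTensor
import Literature.AlgebraicGeometry.Modules.TensorProductLocallyFree
import Literature.AlgebraicGeometry.KTheory.PullbackVectorBundle
import HarnessLib

/-!
# The external tensor product of vector bundles (and of bounded complexes of vector bundles) is a
# vector bundle (a bounded complex of vector bundles)

For finite locally free `M` on `X` and `N` on `Y` and a span `p : Z ⟶ X`, `q : Z ⟶ Y`, the external
tensor product `M ⊠ N = p^*M ⊗ q^*N` (`Modules/BoxTensor.boxTensor`) is finite locally free: pull-back
preserves finite local freeness (The Stacks Project, Tag 01C8; tree
`KTheory/PullbackVectorBundle`, `IsFiniteLocallyFree.pullback`) and so does the tensor product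
(Tag 01CE (7); tree `Modules/TensorProductLocallyFree.isFiniteLocallyFree_tensorObj`). Hence the
external tensor product `E ⊠ F` of two BOUNDED COMPLEXES OF VECTOR BUNDLES
(`Modules/BoxTensor.boxTensorComplex`, the total complex of `(i, j) ↦ Eⁱ ⊠ Fʲ`, Stacks 012Z) is again
a bounded complex of vector bundles (`KTheory/EulerCharacteristic.IsBoundedVBComplex`): its degree-`n`
term is the coproduct of the `Eⁱ ⊠ Fʲ`, `i + j = n`, all but finitely many of which vanish, and a
finite direct sum of finite locally free modules is finite locally free (Hartshorne II.5, p. 109: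
"free if it is isomorphic to a direct sum of copies of `𝒪_X` … locally free if `X` can be covered by
open sets `U` for which `𝓕|_U` is a free `𝒪_X|_U`-module").

* `shortExact_biproduct_fromSubtype_π` — `0 → ⨁_{j ≠ i} f_j → ⨁_j f_j → f_i → 0` is short exact
  (Stacks 09QG: a summand inclusion is a kernel of the complementary projection; Mathlib
  `biproduct.isLimitFromSubtype`);
* `isFiniteLocallyFree_biproduct` — finite direct sums of vector bundles are vector bundles
  (induction on the number of summands with the tree's `isFiniteLocallyFree_of_shortExact`);
* `isFiniteLocallyFree_sigmaObj` — a coproduct whose summands are vector bundles and vanish off a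
  finite set is a vector bundle (it is the finite direct sum of the remaining summands);
* `IsFiniteLocallyFree.boxTensor`, `isFiniteLocallyFree_boxTensorComplex_X`,
  `IsBoundedVBComplex.boxTensorComplex` (+ the abelian-variety form
  `IsBoundedVBComplex.abelianVarietyBoxTensorComplex`).

Everything is proved; no named facts, no instances (finite biproducts in `X.Modules` are supplied
inside proofs by Mathlib's `HasFiniteBiproducts.of_hasFiniteProducts`, and appear in two auxiliary
statements as an instance HYPOTHESIS). Use (Hodge programme, road №4, crux 26512, item (M3) of the
line card, spec (3a) "`IsBoundedVBComplex` preserved"); library only — proves nothing about (N-U),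
26512, №4, HC_AV or HC.

## References

* The Stacks Project, Tags 01C8, 01CE (7), 012Z, 09QG. [StacksProject]
* R. Hartshorne, *Algebraic Geometry*, GTM 52 (1977), II.5 p. 109, II Ex. 5.7 (b). [Hartshorne1977]
-/

noncomputable section

open CategoryTheory CategoryTheory.Limits AlgebraicGeometry

universe u

namespace Literature.AlgebraicGeometry.Modules

open Literature.AlgebraicGeometry.Motives (IsFiniteLocallyFree AbelianVariety)
open Literature.AlgebraicGeometry.KTheory (IsBoundedVBComplex)

variable {X Y Z : Scheme.{u}}

/-! ## Finite direct sums, and coproducts with finitely many non-zero summands -/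

/-- **`0 → ⨁_{j ≠ i} f_j → ⨁_j f_j → f_i → 0` is short exact** (the summand inclusion is a kernel
of the complementary projection, Mathlib `biproduct.isLimitFromSubtype`; both maps split). Finite
biproducts in `X.Modules` are taken as an instance hypothesis (supplied by
`HasFiniteBiproducts.of_hasFiniteProducts` where used). [cite: StacksProject, Tag 09QG] -/
theorem shortExact_biproduct_fromSubtype_π [HasFiniteBiproducts X.Modules] {K : Type} [Fintype K]
    [DecidableEq K] (f : K → X.Modules) (i : K) :
    (ShortComplex.mk (biproduct.fromSubtype f fun j => j ≠ i) (biproduct.π f i)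
      (by simp)).ShortExact where
  exact := ShortComplex.exact_of_f_is_kernel _ (biproduct.isLimitFromSubtype f i)
  mono_f := by
    haveI : IsSplitMono (biproduct.fromSubtype f fun j => j ≠ i) :=
      IsSplitMono.mk' ⟨biproduct.toSubtype f _, biproduct.fromSubtype_toSubtype f _⟩
    infer_instance
  epi_g := by
    haveI : IsSplitEpi (biproduct.π f i) := IsSplitEpi.mk' ⟨biproduct.ι f i, biproduct.ι_π_self f i⟩
    infer_instance

/-- **A finite direct sum of finite locally free `𝒪_X`-modules is finite locally free** (induction
on the number of summands: `⨁_j f_j` is an extension of `f_i` by `⨁_{j ≠ i} f_j`, and extensions of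
vector bundles are vector bundles, tree `isFiniteLocallyFree_of_shortExact`).
[cite: Hartshorne1977, II.5 p. 109 and II Ex. 5.7 (b)] -/
theorem isFiniteLocallyFree_biproduct [HasFiniteBiproducts X.Modules] :
    ∀ (n : ℕ) {K : Type} [Fintype K] [DecidableEq K] (_ : Fintype.card K = n) (f : K → X.Modules),
      (∀ k, IsFiniteLocallyFree (f k)) → IsFiniteLocallyFree (⨁ f)
  | 0, K, _, _, hK, f, _ => by
    haveI : IsEmpty K := Fintype.card_eq_zero_iff.mp hK
    refine KTheory.KZero.isFiniteLocallyFree_of_isZero ?_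
    rw [IsZero.iff_id_eq_zero]
    exact biproduct.hom_ext _ _ fun k => isEmptyElim k
  | n + 1, K, _, _, hK, f, hf => by
    have hne : Nonempty K := Fintype.card_pos_iff.mp (by omega)
    obtain ⟨i⟩ := hne
    have hcard : Fintype.card {j // j ≠ i} = n := by
      rw [Fintype.card_subtype_compl, Fintype.card_subtype_eq, hK]
      rfl
    exact Motives.isFiniteLocallyFree_of_shortExact (shortExact_biproduct_fromSubtype_π f i)
      (isFiniteLocallyFree_biproduct n hcard _ fun j => hf j.1) (hf i)

/-- **A coproduct whose summands are finite locally free and vanish off a finite set `s` is finite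
locally free**: it is isomorphic to the finite direct sum `⨁_{j ∈ s} f_j` (the other summand
inclusions vanish). [cite: Hartshorne1977, II.5 p. 109 and II Ex. 5.7 (b)] -/
theorem isFiniteLocallyFree_sigmaObj {J : Type} (f : J → X.Modules) [HasCoproduct f]
    (s : Finset J) (h0 : ∀ j ∉ s, IsZero (f j)) (hf : ∀ j ∈ s, IsFiniteLocallyFree (f j)) :
    IsFiniteLocallyFree (∐ f) := by
  classical
  haveI : HasFiniteBiproducts X.Modules := HasFiniteBiproducts.of_hasFiniteProducts
  let g : ↥s → X.Modules := fun j => f j.1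
  -- `∐ f ≅ ⨁ g`
  let hom : ∐ f ⟶ ⨁ g := Sigma.desc fun j =>
    if h : j ∈ s then biproduct.ι g ⟨j, h⟩ else 0
  let inv : ⨁ g ⟶ ∐ f := biproduct.desc fun j => Sigma.ι f j.1
  have h₁ : hom ≫ inv = 𝟙 _ := by
    refine Sigma.hom_ext _ _ fun j => ?_
    rw [Sigma.ι_desc_assoc, Category.comp_id]
    by_cases h : j ∈ s
    · rw [dif_pos h, biproduct.ι_desc]
    · rw [dif_neg h, zero_comp]
      exact ((h0 j h).eq_of_src _ _)
  have h₂ : inv ≫ hom = 𝟙 _ := by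
    refine biproduct.hom_ext' _ _ fun j => ?_
    rw [biproduct.ι_desc_assoc, Sigma.ι_desc, dif_pos j.2, Category.comp_id]
  exact isFiniteLocallyFree_of_iso (show ⨁ g ≅ ∐ f from ⟨inv, hom, h₂, h₁⟩)
    (isFiniteLocallyFree_biproduct _ rfl g fun j => hf j.1 j.2)

/-! ## Vector bundles under the external tensor product -/

/-- **`M ⊠ N` is finite locally free for finite locally free `M`, `N`** (pull-backs of vector
bundles are vector bundles, Stacks 01C8, tree `IsFiniteLocallyFree.pullback`; tensor products of
vector bundles are vector bundles, Stacks 01CE (7), tree `isFiniteLocallyFree_tensorObj`). Deliberate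
dot-notation extension of `Motives.IsFiniteLocallyFree` from the `Modules` directory.
[cite: StacksProject, Tag 01CE (7) (with Tag 01C8)] -/
theorem _root_.Literature.AlgebraicGeometry.Motives.IsFiniteLocallyFree.boxTensor (p : Z ⟶ X)
    (q : Z ⟶ Y) {M : X.Modules} {N : Y.Modules} (hM : IsFiniteLocallyFree M)
    (hN : IsFiniteLocallyFree N) : IsFiniteLocallyFree (boxTensor p q M N) :=
  isFiniteLocallyFree_tensorObj _ _ (hM.pullback p) (hN.pullback q)

/-- **The terms of `E ⊠ F` are vector bundles** for bounded complexes of vector bundles `E`, `F`: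
`(E ⊠ F)ⁿ = ∐_{i+j=n} Eⁱ ⊠ Fʲ` with every summand finite locally free and all but finitely many zero.
[cite: StacksProject, Tag 012Z (Definition 12.18.3) (with Tag 01CE (7))] -/
theorem isFiniteLocallyFree_boxTensorComplex_X (p : Z ⟶ X) (q : Z ⟶ Y)
    {E : CochainComplex X.Modules ℤ} {F : CochainComplex Y.Modules ℤ}
    (hE : IsBoundedVBComplex E) (hF : IsBoundedVBComplex F) (n : ℤ) :
    IsFiniteLocallyFree ((boxTensorComplex p q E F).X n) := by
  classical
  obtain ⟨sE, hsE⟩ := hE.exists_finset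
  obtain ⟨sF, hsF⟩ := hF.exists_finset
  haveI := preservesZeroMorphisms_boxTensorFunctor p q
  haveI := preservesZeroMorphisms_boxTensorFunctor_obj p q
  -- the degree-`n` term is the coproduct of the `Eⁱ ⊠ Fʲ`, `i + j = n`
  change IsFiniteLocallyFree (∐ fun i : (ComplexShape.π (ComplexShape.up ℤ) (ComplexShape.up ℤ)
      (ComplexShape.up ℤ)) ⁻¹' {n} => boxTensor p q (E.X i.1.1) (F.X i.1.2))
  refine isFiniteLocallyFree_sigmaObj _
    ((sE.filter fun i => n - i ∈ sF).image fun i => (⟨(i, n - i), by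
      change i + (n - i) = n; omega⟩ : (ComplexShape.π (ComplexShape.up ℤ) (ComplexShape.up ℤ)
        (ComplexShape.up ℤ)) ⁻¹' {n})) (fun j hj => ?_) (fun j _ => ?_)
  · obtain ⟨⟨a, b⟩, hab⟩ := j
    change a + b = n at hab
    by_cases ha : a ∈ sE
    · by_cases hb : b ∈ sF
      · exfalso
        apply hj
        rw [Finset.mem_image]
        refine ⟨a, Finset.mem_filter.mpr ⟨ha, ?_⟩, ?_⟩
        · have : n - a = b := by omega
          rw [this]; exact hb
        · apply Subtype.ext
          change ((a, n - a) : ℤ × ℤ) = (a, b)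
          rw [show n - a = b by omega]
      · exact isZero_boxTensor_of_isZero_right p q _ _ (hsF b hb)
    · exact isZero_boxTensor_of_isZero_left p q _ _ (hsE a ha)
  · exact (hE.isFiniteLocallyFree _).boxTensor p q (hF.isFiniteLocallyFree _)

/-- **The external tensor product of two bounded complexes of vector bundles is a bounded complex of
vector bundles** (terms: `isFiniteLocallyFree_boxTensorComplex_X`; boundedness:
`exists_finset_isZero_boxTensorComplex_X_of_isBoundedVBComplex` of `Modules/BoxTensor`). Deliberate
dot-notation extension of `KTheory.IsBoundedVBComplex` from the `Modules` directory.
[cite: StacksProject, Tag 012Z (Definition 12.18.3) (with Tag 01CE (7))] -/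
theorem _root_.Literature.AlgebraicGeometry.KTheory.IsBoundedVBComplex.boxTensorComplex (p : Z ⟶ X)
    (q : Z ⟶ Y) {E : CochainComplex X.Modules ℤ} {F : CochainComplex Y.Modules ℤ}
    (hE : IsBoundedVBComplex E) (hF : IsBoundedVBComplex F) :
    IsBoundedVBComplex (boxTensorComplex p q E F) :=
  ⟨isFiniteLocallyFree_boxTensorComplex_X p q hE hF,
    exists_finset_isZero_boxTensorComplex_X_of_isBoundedVBComplex p q E F hE hF⟩

/-- **`E ⊠ F` on a product of abelian varieties `A ×ₖ B` is a bounded complex of vector bundles**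
for bounded complexes of vector bundles `E` on `A` and `F` on `B` (the form of (3a) of the Hodge
road's typing spec: `AbelianVariety.boxTensorComplex A B` preserves `IsBoundedVBComplex`).
[cite: StacksProject, Tag 012Z (Definition 12.18.3) (with Tag 01CE (7))] -/
theorem _root_.Literature.AlgebraicGeometry.KTheory.IsBoundedVBComplex.abelianVarietyBoxTensorComplex
    {k : Type u} [Field k] (A B : AbelianVariety k) {E : CochainComplex A.X.left.Modules ℤ}
    {F : CochainComplex B.X.left.Modules ℤ} (hE : IsBoundedVBComplex E) (hF : IsBoundedVBComplex F) :
    IsBoundedVBComplex (AbelianVariety.boxTensorComplex A B E F) :=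
  hE.boxTensorComplex _ _ hF

end Literature.AlgebraicGeometry.Modules

end
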